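import Summits.FinalStateConjecture.FinalStateConjecture.Theorems.EIHFluxBalanceInertialRecessionStubRechartUntwist

/-!
# Route EIHFluxBalance — `InertialRecession` (E′), line `SketchCleanExcision`, skeleton r13,
# stub `stub_higherOrderSlaving` (EF): quantitative transport bounds and the untwisted frame of a
# rotating hole, to order three

Helper file for the crux `stmt-FinalStateConjecture-17403`
(`Summit.FinalStateConjecture.FinalStateConjecture.Theses.EIHFluxBalance.InertialRecession`, E′),
registered stub `stub_higherOrderSlaving` (orders two and three of frozen-vacuum slaving).

The untwisted frame `Λ̃ = Λ·R_θ` of `exists_untwisting_angle'` has the painted `e₀`, `e₃` columns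
`u`, `n` and transported `e₁`, `e₂` columns; the landed decay statement is qualitative, the
absorption argument of higher-order slaving needs the QUANTITATIVE version, uniformly in time:

* `higherOrder_transport_bounds` — `‖p′‖ ≤ K e₁`, `‖p″‖ ≤ K (e₂ + e₁²)`,
  `‖p‴‖ ≤ K (e₃ + e₂ e₁ + e₁³)`, `e_k = ‖u⁽ᵏ⁾‖ + ‖n⁽ᵏ⁾‖`, with `K` depending only on the
  uniform bound of `u, n, p` (differentiate the transport law twice);
* `higherOrder_exists_transportFrame` — for a smooth Lorentz path with Lorentz factor `≤ γ`: a
  smooth Lorentz path `Λ̃` painting the same Kerr–Schild field (`boostedKerrBilin_mul_rotL`), with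
  the same `e₀` and `e₃` columns, and `‖Λ̃′‖ ≤ K e₁`, `‖Λ̃″‖ ≤ K(e₂ + e₁²)`,
  `‖Λ̃‴‖ ≤ K(e₃ + e₂e₁ + e₁³)` at every time (operator norm through the columns).

No definitions, no named facts, no `sorry`.
-/

set_option linter.dupNamespace false
set_option maxSynthPendingDepth 6
set_option synthInstance.maxHeartbeats 200000

noncomputable section

namespace Summit.FinalStateConjecture.FinalStateConjecture.Theorems.SublinearIsFree.Slaving

open scoped Topology ContDiff
open Filter Set Function Literature.Geometry.Lorentzian
  Summit.FinalStateConjecture.FinalStateConjecture.Theorems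
  Summit.FinalStateConjecture.FinalStateConjecture.Theorems.InertialRecession.Negative
  Summit.FinalStateConjecture.FinalStateConjecture.Theorems.SublinearIsFree.Rechart

/-! ### Quantitative transport bounds -/

/-- Monomial bookkeeping: `mⁱ Cʲ ≤ (1+m)³ (1+C)⁴` for `i ≤ 3`, `j ≤ 4`, `m, C ≥ 0`. [folklore] -/
theorem higherOrder_pow_mul_pow_le {m C : ℝ} (hm : 0 ≤ m) (hC : 0 ≤ C) {i j : ℕ} (hi : i ≤ 3)
    (hj : j ≤ 4) : m ^ i * C ^ j ≤ (1 + m) ^ 3 * (1 + C) ^ 4 := by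
  have h1 : m ^ i ≤ (1 + m) ^ 3 :=
    (pow_le_pow_left₀ hm (by linarith) i).trans (pow_le_pow_right₀ (by linarith) hi)
  have h2 : C ^ j ≤ (1 + C) ^ 4 :=
    (pow_le_pow_left₀ hC (by linarith) j).trans (pow_le_pow_right₀ (by linarith) hj)
  exact mul_le_mul h1 h2 (by positivity) (by positivity)

set_option maxHeartbeats 1600000 in
/-- **Quantitative transport bounds.** Let `u, n, p : ℝ → E4` be smooth and bounded by `C`, and
let `p` obey the transport law `p′ = η(p, u′) u − η(p, n′) n`. Then at every time, with
`e_k = ‖u⁽ᵏ⁾‖ + ‖n⁽ᵏ⁾‖` and `K = 64 (1 + ‖η‖)³ (1 + C)⁴`: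
`‖p′‖ ≤ K e₁`, `‖p″‖ ≤ K (e₂ + e₁²)`, `‖p‴‖ ≤ K (e₃ + e₂ e₁ + e₁³)`. [folklore] -/
theorem higherOrder_transport_bounds {u n p : ℝ → E4} {C : ℝ} (hC : 0 ≤ C)
    (hu : ContDiff ℝ ∞ u) (hn : ContDiff ℝ ∞ n) (hp : ContDiff ℝ ∞ p)
    (hub : ∀ t, ‖u t‖ ≤ C) (hnb : ∀ t, ‖n t‖ ≤ C) (hpb : ∀ t, ‖p t‖ ≤ C)
    (hode : ∀ t, deriv p t = (Minkowski.bilin (p t) (deriv u t)) • u t -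
      (Minkowski.bilin (p t) (deriv n t)) • n t) (t : ℝ) :
    ‖deriv p t‖ ≤ 64 * (1 + ‖(Minkowski.bilin : E4 →L[ℝ] E4 →L[ℝ] ℝ)‖) ^ 3 * (1 + C) ^ 4 *
      (‖deriv u t‖ + ‖deriv n t‖) ∧
    ‖iteratedDeriv 2 p t‖ ≤ 64 * (1 + ‖(Minkowski.bilin : E4 →L[ℝ] E4 →L[ℝ] ℝ)‖) ^ 3 * (1 + C) ^ 4 *
      ((‖iteratedDeriv 2 u t‖ + ‖iteratedDeriv 2 n t‖) + (‖deriv u t‖ + ‖deriv n t‖) ^ 2) ∧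
    ‖iteratedDeriv 3 p t‖ ≤ 64 * (1 + ‖(Minkowski.bilin : E4 →L[ℝ] E4 →L[ℝ] ℝ)‖) ^ 3 * (1 + C) ^ 4 *
      ((‖iteratedDeriv 3 u t‖ + ‖iteratedDeriv 3 n t‖) +
        (‖iteratedDeriv 2 u t‖ + ‖iteratedDeriv 2 n t‖) * (‖deriv u t‖ + ‖deriv n t‖) +
        (‖deriv u t‖ + ‖deriv n t‖) ^ 3) := by
  set η : E4 →L[ℝ] E4 →L[ℝ] ℝ := Minkowski.bilin with hη
  set m : ℝ := ‖η‖ with hm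
  have hm0 : 0 ≤ m := norm_nonneg _
  set Q : ℝ := (1 + m) ^ 3 * (1 + C) ^ 4 with hQ
  have hQ0 : 0 ≤ Q := by positivity
  have hmon : ∀ {i j : ℕ}, i ≤ 3 → j ≤ 4 → m ^ i * C ^ j ≤ Q := fun hi hj ↦
    higherOrder_pow_mul_pow_le hm0 hC hi hj
  -- derivatives of the paths
  set u₁ := deriv u with hu₁
  set u₂ := iteratedDeriv 2 u with hu₂
  set u₃ := iteratedDeriv 3 u with hu₃
  set n₁ := deriv n with hn₁
  set n₂ := iteratedDeriv 2 n with hn₂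
  set n₃ := iteratedDeriv 3 n with hn₃
  set p₁ := deriv p with hp₁
  have hdu : ∀ s, HasDerivAt u (u₁ s) s := fun s ↦ (hu.differentiable (by simp) s).hasDerivAt
  have hdn : ∀ s, HasDerivAt n (n₁ s) s := fun s ↦ (hn.differentiable (by simp) s).hasDerivAt
  have hdp : ∀ s, HasDerivAt p (p₁ s) s := fun s ↦ (hp.differentiable (by simp) s).hasDerivAt
  have hu₁c : ContDiff ℝ ∞ u₁ := (contDiff_infty_iff_deriv.mp hu).2
  have hn₁c : ContDiff ℝ ∞ n₁ := (contDiff_infty_iff_deriv.mp hn).2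
  have hdu₁ : ∀ s, HasDerivAt u₁ (u₂ s) s := fun s ↦ by
    rw [hu₂, iteratedDeriv_succ, iteratedDeriv_one]
    exact (hu₁c.differentiable (by simp) s).hasDerivAt
  have hdn₁ : ∀ s, HasDerivAt n₁ (n₂ s) s := fun s ↦ by
    rw [hn₂, iteratedDeriv_succ, iteratedDeriv_one]
    exact (hn₁c.differentiable (by simp) s).hasDerivAt
  have hu₂c : ContDiff ℝ ∞ u₂ := by
    rw [hu₂, iteratedDeriv_succ, iteratedDeriv_one]; exact (contDiff_infty_iff_deriv.mp hu₁c).2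
  have hn₂c : ContDiff ℝ ∞ n₂ := by
    rw [hn₂, iteratedDeriv_succ, iteratedDeriv_one]; exact (contDiff_infty_iff_deriv.mp hn₁c).2
  have hdu₂ : ∀ s, HasDerivAt u₂ (u₃ s) s := fun s ↦ by
    rw [hu₃, iteratedDeriv_succ]; exact (hu₂c.differentiable (by simp) s).hasDerivAt
  have hdn₂ : ∀ s, HasDerivAt n₂ (n₃ s) s := fun s ↦ by
    rw [hn₃, iteratedDeriv_succ]; exact (hn₂c.differentiable (by simp) s).hasDerivAt
  -- the scalar factors and their derivatives
  set gu : ℝ → ℝ := fun s ↦ η (p s) (u₁ s) with hgu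
  set gn : ℝ → ℝ := fun s ↦ η (p s) (n₁ s) with hgn
  set gu' : ℝ → ℝ := fun s ↦ η (p₁ s) (u₁ s) + η (p s) (u₂ s) with hgu'
  set gn' : ℝ → ℝ := fun s ↦ η (p₁ s) (n₁ s) + η (p s) (n₂ s) with hgn'
  have hηp : ∀ s, HasDerivAt (fun r ↦ η (p r)) (η (p₁ s)) s := fun s ↦
    η.hasFDerivAt.comp_hasDerivAt s (hdp s)
  have hdgu : ∀ s, HasDerivAt gu (gu' s) s := fun s ↦ (hηp s).clm_apply (hdu₁ s)
  have hdgn : ∀ s, HasDerivAt gn (gn' s) s := fun s ↦ (hηp s).clm_apply (hdn₁ s)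
  -- first derivative as a function, and the second derivative
  have hp₁eq : p₁ = fun s ↦ gu s • u s - gn s • n s := funext fun s ↦ hode s
  set p₂f : ℝ → E4 := fun s ↦ (gu s • u₁ s + gu' s • u s) - (gn s • n₁ s + gn' s • n s) with hp₂f
  have hdp₁ : ∀ s, HasDerivAt p₁ (p₂f s) s := fun s ↦ by
    rw [hp₁eq]
    exact ((hdgu s).smul (hdu s)).sub ((hdgn s).smul (hdn s))
  have hp₂eq : iteratedDeriv 2 p = p₂f := by
    rw [iteratedDeriv_succ, iteratedDeriv_one]
    exact funext fun s ↦ (hdp₁ s).deriv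
  -- the third derivative at `t`
  have hp₁c : ∀ s, HasDerivAt p₁ (p₂f s) s := hdp₁
  have hηp₁ : HasDerivAt (fun r ↦ η (p₁ r)) (η (p₂f t)) t := η.hasFDerivAt.comp_hasDerivAt t (hp₁c t)
  have hdgu' : HasDerivAt gu' (η (p₂f t) (u₁ t) + η (p₁ t) (u₂ t) + (η (p₁ t) (u₂ t) + η (p t) (u₃ t))) t :=
    (hηp₁.clm_apply (hdu₁ t)).add ((hηp t).clm_apply (hdu₂ t))
  have hdgn' : HasDerivAt gn' (η (p₂f t) (n₁ t) + η (p₁ t) (n₂ t) + (η (p₁ t) (n₂ t) + η (p t) (n₃ t))) t :=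
    (hηp₁.clm_apply (hdn₁ t)).add ((hηp t).clm_apply (hdn₂ t))
  have hdp₂ : HasDerivAt p₂f
      (((gu t • u₂ t + gu' t • u₁ t) + (gu' t • u₁ t +
          (η (p₂f t) (u₁ t) + η (p₁ t) (u₂ t) + (η (p₁ t) (u₂ t) + η (p t) (u₃ t))) • u t)) -
        ((gn t • n₂ t + gn' t • n₁ t) + (gn' t • n₁ t +
          (η (p₂f t) (n₁ t) + η (p₁ t) (n₂ t) + (η (p₁ t) (n₂ t) + η (p t) (n₃ t))) • n t))) t :=
    ((((hdgu t).smul (hdu₁ t)).add (hdgu'.smul (hdu t))).sub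
      (((hdgn t).smul (hdn₁ t)).add (hdgn'.smul (hdn t))))
  have hp₃eq : iteratedDeriv 3 p t = ((gu t • u₂ t + gu' t • u₁ t) + (gu' t • u₁ t +
          (η (p₂f t) (u₁ t) + η (p₁ t) (u₂ t) + (η (p₁ t) (u₂ t) + η (p t) (u₃ t))) • u t)) -
        ((gn t • n₂ t + gn' t • n₁ t) + (gn' t • n₁ t +
          (η (p₂f t) (n₁ t) + η (p₁ t) (n₂ t) + (η (p₁ t) (n₂ t) + η (p t) (n₃ t))) • n t)) := by
    rw [iteratedDeriv_succ, hp₂eq, hdp₂.deriv]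
  -- sizes
  set a₁ := ‖u₁ t‖ + ‖n₁ t‖ with ha₁
  set a₂ := ‖u₂ t‖ + ‖n₂ t‖ with ha₂
  set a₃ := ‖u₃ t‖ + ‖n₃ t‖ with ha₃
  have ha₁0 : 0 ≤ a₁ := by positivity
  have ha₂0 : 0 ≤ a₂ := by positivity
  have ha₃0 : 0 ≤ a₃ := by positivity
  have hu₁a : ‖u₁ t‖ ≤ a₁ := le_add_of_nonneg_right (norm_nonneg _)
  have hn₁a : ‖n₁ t‖ ≤ a₁ := le_add_of_nonneg_left (norm_nonneg _)
  have hu₂a : ‖u₂ t‖ ≤ a₂ := le_add_of_nonneg_right (norm_nonneg _)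
  have hn₂a : ‖n₂ t‖ ≤ a₂ := le_add_of_nonneg_left (norm_nonneg _)
  have hu₃a : ‖u₃ t‖ ≤ a₃ := le_add_of_nonneg_right (norm_nonneg _)
  have hn₃a : ‖n₃ t‖ ≤ a₃ := le_add_of_nonneg_left (norm_nonneg _)
  have hηle : ∀ x y : E4, |η x y| ≤ m * ‖x‖ * ‖y‖ := fun x y ↦ by
    rw [← Real.norm_eq_abs]; exact η.le_opNorm₂ x y
  -- `‖p′‖`
  have hgu0 : |gu t| ≤ m * C * a₁ := (hηle _ _).trans (by gcongr; exact hpb t)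
  have hgn0 : |gn t| ≤ m * C * a₁ := (hηle _ _).trans (by gcongr; exact hpb t)
  have hP1 : ‖p₁ t‖ ≤ 2 * m * C ^ 2 * a₁ := by
    rw [hp₁eq]
    calc ‖gu t • u t - gn t • n t‖ ≤ ‖gu t • u t‖ + ‖gn t • n t‖ := norm_sub_le _ _
      _ ≤ (m * C * a₁) * C + (m * C * a₁) * C := by
          rw [norm_smul, norm_smul, Real.norm_eq_abs, Real.norm_eq_abs]
          exact add_le_add (mul_le_mul hgu0 (hub t) (norm_nonneg _) (by positivity))
            (mul_le_mul hgn0 (hnb t) (norm_nonneg _) (by positivity))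
      _ = 2 * m * C ^ 2 * a₁ := by ring
  -- `‖p″‖`
  have hgu1 : |gu' t| ≤ m * (2 * m * C ^ 2 * a₁) * a₁ + m * C * a₂ := by
    refine (abs_add_le _ _).trans (add_le_add ((hηle _ _).trans ?_) ((hηle _ _).trans ?_))
    · gcongr
    · gcongr; exact hpb t
  have hgn1 : |gn' t| ≤ m * (2 * m * C ^ 2 * a₁) * a₁ + m * C * a₂ := by
    refine (abs_add_le _ _).trans (add_le_add ((hηle _ _).trans ?_) ((hηle _ _).trans ?_))
    · gcongr
    · gcongr; exact hpb t
  set B₂ : ℝ := (m * C * a₁) * a₁ + (m * (2 * m * C ^ 2 * a₁) * a₁ + m * C * a₂) * C with hB₂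
  have hterm2 : ∀ (g g' : ℝ) (x x₁ : E4), |g| ≤ m * C * a₁ →
      |g'| ≤ m * (2 * m * C ^ 2 * a₁) * a₁ + m * C * a₂ → ‖x‖ ≤ C → ‖x₁‖ ≤ a₁ →
      ‖g • x₁ + g' • x‖ ≤ B₂ := by
    intro g g' x x₁ hg hg' hx hx₁
    calc ‖g • x₁ + g' • x‖ ≤ ‖g • x₁‖ + ‖g' • x‖ := norm_add_le _ _
      _ ≤ (m * C * a₁) * a₁ + (m * (2 * m * C ^ 2 * a₁) * a₁ + m * C * a₂) * C := by
          rw [norm_smul, norm_smul, Real.norm_eq_abs, Real.norm_eq_abs]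
          exact add_le_add (mul_le_mul hg hx₁ (norm_nonneg _) (by positivity))
            (mul_le_mul hg' hx (norm_nonneg _) (by positivity))
  have hP2f : ‖p₂f t‖ ≤ 2 * B₂ := by
    calc ‖p₂f t‖ ≤ ‖gu t • u₁ t + gu' t • u t‖ + ‖gn t • n₁ t + gn' t • n t‖ := norm_sub_le _ _
      _ ≤ B₂ + B₂ := add_le_add (hterm2 _ _ _ _ hgu0 hgu1 (hub t) hu₁a)
          (hterm2 _ _ _ _ hgn0 hgn1 (hnb t) hn₁a)
      _ = 2 * B₂ := by ring
  have hP2 : ‖iteratedDeriv 2 p t‖ ≤ 2 * B₂ := by rw [hp₂eq]; exact hP2f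
  -- `‖p‴‖`
  set G₂ : ℝ := m * (2 * B₂) * a₁ + m * (2 * m * C ^ 2 * a₁) * a₂ +
    (m * (2 * m * C ^ 2 * a₁) * a₂ + m * C * a₃) with hG₂
  have hgu2 : |η (p₂f t) (u₁ t) + η (p₁ t) (u₂ t) + (η (p₁ t) (u₂ t) + η (p t) (u₃ t))| ≤ G₂ := by
    refine (abs_add_le _ _).trans (add_le_add ((abs_add_le _ _).trans (add_le_add
      ((hηle _ _).trans ?_) ((hηle _ _).trans ?_))) ((abs_add_le _ _).trans (add_le_add
      ((hηle _ _).trans ?_) ((hηle _ _).trans ?_))))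
    · gcongr
    · gcongr
    · gcongr
    · gcongr; exact hpb t
  have hgn2 : |η (p₂f t) (n₁ t) + η (p₁ t) (n₂ t) + (η (p₁ t) (n₂ t) + η (p t) (n₃ t))| ≤ G₂ := by
    refine (abs_add_le _ _).trans (add_le_add ((abs_add_le _ _).trans (add_le_add
      ((hηle _ _).trans ?_) ((hηle _ _).trans ?_))) ((abs_add_le _ _).trans (add_le_add
      ((hηle _ _).trans ?_) ((hηle _ _).trans ?_))))
    · gcongr
    · gcongr
    · gcongr
    · gcongr; exact hpb t
  set B₃ : ℝ := ((m * C * a₁) * a₂ + (m * (2 * m * C ^ 2 * a₁) * a₁ + m * C * a₂) * a₁) +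
    ((m * (2 * m * C ^ 2 * a₁) * a₁ + m * C * a₂) * a₁ + G₂ * C) with hB₃
  have hterm3 : ∀ (g g' g'' : ℝ) (x x₁ x₂ : E4), |g| ≤ m * C * a₁ →
      |g'| ≤ m * (2 * m * C ^ 2 * a₁) * a₁ + m * C * a₂ → |g''| ≤ G₂ → ‖x‖ ≤ C → ‖x₁‖ ≤ a₁ →
      ‖x₂‖ ≤ a₂ → ‖(g • x₂ + g' • x₁) + (g' • x₁ + g'' • x)‖ ≤ B₃ := by
    intro g g' g'' x x₁ x₂ hg hg' hg'' hx hx₁ hx₂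
    calc _ ≤ (‖g • x₂‖ + ‖g' • x₁‖) + (‖g' • x₁‖ + ‖g'' • x‖) :=
          (norm_add_le _ _).trans (add_le_add (norm_add_le _ _) (norm_add_le _ _))
      _ ≤ B₃ := by
          simp only [norm_smul, Real.norm_eq_abs, hB₃]
          gcongr
  have hP3 : ‖iteratedDeriv 3 p t‖ ≤ 2 * B₃ := by
    rw [hp₃eq]
    calc _ ≤ ‖(gu t • u₂ t + gu' t • u₁ t) + (gu' t • u₁ t +
          (η (p₂f t) (u₁ t) + η (p₁ t) (u₂ t) + (η (p₁ t) (u₂ t) + η (p t) (u₃ t))) • u t)‖ +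
        ‖(gn t • n₂ t + gn' t • n₁ t) + (gn' t • n₁ t +
          (η (p₂f t) (n₁ t) + η (p₁ t) (n₂ t) + (η (p₁ t) (n₂ t) + η (p t) (n₃ t))) • n t)‖ :=
          norm_sub_le _ _
      _ ≤ B₃ + B₃ := add_le_add (hterm3 _ _ _ _ _ _ hgu0 hgu1 hgu2 (hub t) hu₁a hu₂a)
          (hterm3 _ _ _ _ _ _ hgn0 hgn1 hgn2 (hnb t) hn₁a hn₂a)
      _ = 2 * B₃ := by ring
  -- conversion to the clean polynomial forms
  have c12 : m * C ^ 2 ≤ Q := by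
    have h := hmon (i := 1) (j := 2) (by norm_num) (by norm_num); rwa [pow_one] at h
  have c11 : m * C ≤ Q := by
    have h := hmon (i := 1) (j := 1) (by norm_num) (by norm_num); rwa [pow_one, pow_one] at h
  have c23 : m ^ 2 * C ^ 3 ≤ Q := hmon (i := 2) (j := 3) (by norm_num) (by norm_num)
  have c22 : m ^ 2 * C ^ 2 ≤ Q := hmon (i := 2) (j := 2) (by norm_num) (by norm_num)
  have c34 : m ^ 3 * C ^ 4 ≤ Q := hmon (i := 3) (j := 4) (by norm_num) (by norm_num)
  refine ⟨?_, ?_, ?_⟩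
  · calc ‖p₁ t‖ ≤ 2 * m * C ^ 2 * a₁ := hP1
      _ = 2 * (m * C ^ 2) * a₁ := by ring
      _ ≤ 2 * Q * a₁ := by gcongr
      _ ≤ 64 * Q * a₁ := by
          have h : 0 ≤ 62 * (Q * a₁) := by positivity
          linarith only [h]
      _ = 64 * (1 + m) ^ 3 * (1 + C) ^ 4 * a₁ := by rw [hQ]; ring
  · calc ‖iteratedDeriv 2 p t‖ ≤ 2 * B₂ := hP2
      _ = (2 * (m * C) + 4 * (m ^ 2 * C ^ 3)) * a₁ ^ 2 + 2 * (m * C ^ 2) * a₂ := by rw [hB₂]; ring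
      _ ≤ (2 * Q + 4 * Q) * a₁ ^ 2 + 2 * Q * a₂ := by gcongr
      _ ≤ 64 * Q * (a₂ + a₁ ^ 2) := by
          have h : 0 ≤ 62 * (Q * a₂) + 58 * (Q * a₁ ^ 2) := by positivity
          linarith only [h]
      _ = 64 * (1 + m) ^ 3 * (1 + C) ^ 4 * (a₂ + a₁ ^ 2) := by rw [hQ]; ring
  · calc ‖iteratedDeriv 3 p t‖ ≤ 2 * B₃ := hP3
      _ = (6 * (m * C) + 12 * (m ^ 2 * C ^ 3)) * (a₂ * a₁) + (12 * (m ^ 2 * C ^ 2) +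
            8 * (m ^ 3 * C ^ 4)) * a₁ ^ 3 + 2 * (m * C ^ 2) * a₃ := by rw [hB₃, hG₂, hB₂]; ring
      _ ≤ (6 * Q + 12 * Q) * (a₂ * a₁) + (12 * Q + 8 * Q) * a₁ ^ 3 + 2 * Q * a₃ := by gcongr
      _ ≤ 64 * Q * (a₃ + a₂ * a₁ + a₁ ^ 3) := by
          have h : 0 ≤ 46 * (Q * (a₂ * a₁)) + 44 * (Q * a₁ ^ 3) + 62 * (Q * a₃) := by positivity
          linarith only [h]
      _ = 64 * (1 + m) ^ 3 * (1 + C) ^ 4 * (a₃ + a₂ * a₁ + a₁ ^ 3) := by rw [hQ]; ring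

/-! ### The untwisted frame of a rotating hole with quantitative bounds -/

set_option maxHeartbeats 1600000 in
/-- **The untwisted frame, quantitatively.** For a smooth Lorentz path `Λ` with Lorentz factor
`≤ γ` there are a smooth Lorentz path `Λ̃` and `K ≥ 0` such that: `Λ̃` paints the same
Kerr–Schild field (for all centres, masses, spins), has the same `e₀` and `e₃` columns `u`, `n`,
and at every time `‖Λ̃′‖ ≤ K e₁`, `‖Λ̃″‖ ≤ K (e₂ + e₁²)`, `‖Λ̃‴‖ ≤ K (e₃ + e₂ e₁ + e₁³)` with
`e_k = ‖u⁽ᵏ⁾‖ + ‖n⁽ᵏ⁾‖` (`exists_untwisting_angle'`, `boostedKerrBilin_mul_rotL`,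
`higherOrder_transport_bounds`, operator norm through the columns). [folklore] -/
theorem higherOrder_exists_transportFrame (Λ : ℝ → lorentzGroup) {γ : ℝ}
    (hΛ : ContDiff ℝ ∞ (fun t ↦ ((Λ t : E4 ≃L[ℝ] E4) : E4 →L[ℝ] E4)))
    (hγ : ∀ t, |((Λ t : E4 ≃L[ℝ] E4) (E4.basisVector 0)) 0| ≤ γ) :
    ∃ (Λ' : ℝ → lorentzGroup) (K : ℝ), 0 ≤ K ∧
      ContDiff ℝ ∞ (fun t ↦ ((Λ' t : E4 ≃L[ℝ] E4) : E4 →L[ℝ] E4)) ∧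
      (∀ t c M a z, boostedKerrBilin (Λ' t) c M a z = boostedKerrBilin (Λ t) c M a z) ∧
      (∀ t, (Λ' t : E4 ≃L[ℝ] E4) (E4.basisVector 0) = (Λ t : E4 ≃L[ℝ] E4) (E4.basisVector 0)) ∧
      (∀ t, (Λ' t : E4 ≃L[ℝ] E4) (E4.basisVector 3) = (Λ t : E4 ≃L[ℝ] E4) (E4.basisVector 3)) ∧
      ∀ t, ‖iteratedDeriv 1 (fun s ↦ ((Λ' s : E4 ≃L[ℝ] E4) : E4 →L[ℝ] E4)) t‖ ≤
          K * (‖iteratedDeriv 1 (fun s ↦ (Λ s : E4 ≃L[ℝ] E4) (E4.basisVector 0)) t‖ +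
            ‖iteratedDeriv 1 (fun s ↦ (Λ s : E4 ≃L[ℝ] E4) (E4.basisVector 3)) t‖) ∧
        ‖iteratedDeriv 2 (fun s ↦ ((Λ' s : E4 ≃L[ℝ] E4) : E4 →L[ℝ] E4)) t‖ ≤
          K * ((‖iteratedDeriv 2 (fun s ↦ (Λ s : E4 ≃L[ℝ] E4) (E4.basisVector 0)) t‖ +
            ‖iteratedDeriv 2 (fun s ↦ (Λ s : E4 ≃L[ℝ] E4) (E4.basisVector 3)) t‖) +
            (‖iteratedDeriv 1 (fun s ↦ (Λ s : E4 ≃L[ℝ] E4) (E4.basisVector 0)) t‖ +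
            ‖iteratedDeriv 1 (fun s ↦ (Λ s : E4 ≃L[ℝ] E4) (E4.basisVector 3)) t‖) ^ 2) ∧
        ‖iteratedDeriv 3 (fun s ↦ ((Λ' s : E4 ≃L[ℝ] E4) : E4 →L[ℝ] E4)) t‖ ≤
          K * ((‖iteratedDeriv 3 (fun s ↦ (Λ s : E4 ≃L[ℝ] E4) (E4.basisVector 0)) t‖ +
            ‖iteratedDeriv 3 (fun s ↦ (Λ s : E4 ≃L[ℝ] E4) (E4.basisVector 3)) t‖) +
            (‖iteratedDeriv 2 (fun s ↦ (Λ s : E4 ≃L[ℝ] E4) (E4.basisVector 0)) t‖ +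
            ‖iteratedDeriv 2 (fun s ↦ (Λ s : E4 ≃L[ℝ] E4) (E4.basisVector 3)) t‖) *
            (‖iteratedDeriv 1 (fun s ↦ (Λ s : E4 ≃L[ℝ] E4) (E4.basisVector 0)) t‖ +
            ‖iteratedDeriv 1 (fun s ↦ (Λ s : E4 ≃L[ℝ] E4) (E4.basisVector 3)) t‖) +
            (‖iteratedDeriv 1 (fun s ↦ (Λ s : E4 ≃L[ℝ] E4) (E4.basisVector 0)) t‖ +
            ‖iteratedDeriv 1 (fun s ↦ (Λ s : E4 ≃L[ℝ] E4) (E4.basisVector 3)) t‖) ^ 3) := by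
  obtain ⟨θ, -, hFts, hc0, hc3, hode⟩ := exists_untwisting_angle' Λ hΛ
  set Ft : ℝ → E4 →L[ℝ] E4 :=
    fun t ↦ (((Λ t * rotL (θ t) : lorentzGroup) : E4 ≃L[ℝ] E4) : E4 →L[ℝ] E4) with hFt
  set u : ℝ → E4 := fun t ↦ (Λ t : E4 ≃L[ℝ] E4) (E4.basisVector 0) with hudef
  set n : ℝ → E4 := fun t ↦ (Λ t : E4 ≃L[ℝ] E4) (E4.basisVector 3) with hndef
  set p : ℝ → E4 := fun t ↦ Ft t (E4.basisVector 1) with hpdef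
  set q : ℝ → E4 := fun t ↦ Ft t (E4.basisVector 2) with hqdef
  have hcol : ∀ v : E4, ContDiff ℝ ∞ fun t ↦ Ft t v := fun v ↦ hFts.clm_apply contDiff_const
  have hus : ContDiff ℝ ∞ u := hΛ.clm_apply contDiff_const
  have hns : ContDiff ℝ ∞ n := hΛ.clm_apply contDiff_const
  have hps : ContDiff ℝ ∞ p := hcol _
  have hqs : ContDiff ℝ ∞ q := hcol _
  have c0 : (fun t ↦ Ft t (E4.basisVector 0)) = u := funext fun t ↦ hc0 t
  have c3 : (fun t ↦ Ft t (E4.basisVector 3)) = n := funext fun t ↦ hc3 t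
  have hpode : ∀ t, deriv p t = (Minkowski.bilin (p t) (deriv u t)) • u t -
      (Minkowski.bilin (p t) (deriv n t)) • n t := fun t ↦ hode 1 (Or.inl rfl) t
  have hqode : ∀ t, deriv q t = (Minkowski.bilin (q t) (deriv u t)) • u t -
      (Minkowski.bilin (q t) (deriv n t)) • n t := fun t ↦ hode 2 (Or.inr rfl) t
  -- uniform bounds on the columns
  set C : ℝ := 1 + 3 * γ with hC
  have hγ1 : 1 ≤ γ := (one_le_abs_lorentz_apply_zero (Λ 0)).trans (hγ 0)
  have hC0 : 0 ≤ C := by rw [hC]; linarith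
  have hγt : ∀ t, |(((Λ t * rotL (θ t) : lorentzGroup) : E4 ≃L[ℝ] E4) (E4.basisVector 0)) 0| ≤ γ :=
    fun t ↦ by rw [hc0 t]; exact hγ t
  have hcoln : ∀ (L : lorentzGroup), |((L : E4 ≃L[ℝ] E4) (E4.basisVector 0)) 0| ≤ γ →
      ∀ μ : Fin 4, ‖(L : E4 ≃L[ℝ] E4) (E4.basisVector μ)‖ ≤ C := fun L hL μ ↦ by
    have h1 := ((L : E4 ≃L[ℝ] E4) : E4 →L[ℝ] E4).le_opNorm (E4.basisVector μ)
    rw [show ‖(E4.basisVector μ : E4)‖ = 1 by simp, mul_one] at h1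
    exact h1.trans ((norm_lorentz_le L).trans (by rw [hC]; linarith))
  have hub : ∀ t, ‖u t‖ ≤ C := fun t ↦ hcoln (Λ t) (hγ t) 0
  have hnb : ∀ t, ‖n t‖ ≤ C := fun t ↦ hcoln (Λ t) (hγ t) 3
  have hpb : ∀ t, ‖p t‖ ≤ C := fun t ↦ hcoln (Λ t * rotL (θ t)) (hγt t) 1
  have hqb : ∀ t, ‖q t‖ ≤ C := fun t ↦ hcoln (Λ t * rotL (θ t)) (hγt t) 2
  -- the transport bounds
  set K₀ : ℝ := 64 * (1 + ‖(Minkowski.bilin : E4 →L[ℝ] E4 →L[ℝ] ℝ)‖) ^ 3 * (1 + C) ^ 4 with hK₀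
  have hK₀0 : 0 ≤ K₀ := by positivity
  have hPb := fun t ↦ higherOrder_transport_bounds hC0 hus hns hps hub hnb hpb hpode t
  have hQb := fun t ↦ higherOrder_transport_bounds hC0 hus hns hqs hub hnb hqb hqode t
  -- the operator norm through the columns
  have hop : ∀ (k : ℕ) (t : ℝ), ‖iteratedDeriv k Ft t‖ ≤ ‖iteratedDeriv k u t‖ +
      ‖iteratedDeriv k p t‖ + ‖iteratedDeriv k q t‖ + ‖iteratedDeriv k n t‖ := by
    intro k t
    have h := opNorm_le_sum_norm_apply_basisVector (iteratedDeriv k Ft t)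
    rw [Fin.sum_univ_four] at h
    simp only [← iteratedDeriv_clm_apply_const hFts] at h
    rw [c0, c3] at h
    linarith
  refine ⟨fun t ↦ Λ t * rotL (θ t), 1 + 2 * K₀, by positivity, hFts,
    fun t c M a z ↦ boostedKerrBilin_mul_rotL (Λ t) (θ t) c M a z, hc0, hc3, fun t ↦ ⟨?_, ?_, ?_⟩⟩
  · have h := hop 1 t
    simp only [iteratedDeriv_one] at h ⊢
    have hp1 := (hPb t).1
    have hq1 := (hQb t).1
    have he : 0 ≤ ‖deriv u t‖ + ‖deriv n t‖ := by positivity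
    calc ‖deriv Ft t‖ ≤ ‖deriv u t‖ + ‖deriv p t‖ + ‖deriv q t‖ + ‖deriv n t‖ := h
      _ ≤ ‖deriv u t‖ + K₀ * (‖deriv u t‖ + ‖deriv n t‖) + K₀ * (‖deriv u t‖ + ‖deriv n t‖) +
          ‖deriv n t‖ := by gcongr
      _ = (1 + 2 * K₀) * (‖deriv u t‖ + ‖deriv n t‖) := by ring
  · have h := hop 2 t
    have hp2 := (hPb t).2.1
    have hq2 := (hQb t).2.1
    simp only [iteratedDeriv_one] at hp2 hq2 ⊢
    set e₁ := ‖deriv u t‖ + ‖deriv n t‖ with he₁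
    set e₂ := ‖iteratedDeriv 2 u t‖ + ‖iteratedDeriv 2 n t‖ with he₂
    have he₂' : ‖iteratedDeriv 2 u t‖ + ‖iteratedDeriv 2 n t‖ ≤ 1 * (e₂ + e₁ ^ 2) := by
      rw [one_mul, he₂]; exact le_add_of_nonneg_right (sq_nonneg _)
    calc ‖iteratedDeriv 2 Ft t‖ ≤ ‖iteratedDeriv 2 u t‖ + ‖iteratedDeriv 2 p t‖ +
        ‖iteratedDeriv 2 q t‖ + ‖iteratedDeriv 2 n t‖ := h
      _ ≤ (‖iteratedDeriv 2 u t‖ + ‖iteratedDeriv 2 n t‖) + K₀ * (e₂ + e₁ ^ 2) + K₀ * (e₂ + e₁ ^ 2) := by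
          linarith
      _ ≤ 1 * (e₂ + e₁ ^ 2) + K₀ * (e₂ + e₁ ^ 2) + K₀ * (e₂ + e₁ ^ 2) := by gcongr
      _ = (1 + 2 * K₀) * (e₂ + e₁ ^ 2) := by ring
  · have h := hop 3 t
    have hp3 := (hPb t).2.2
    have hq3 := (hQb t).2.2
    simp only [iteratedDeriv_one] at hp3 hq3 ⊢
    set e₁ := ‖deriv u t‖ + ‖deriv n t‖ with he₁
    set e₂ := ‖iteratedDeriv 2 u t‖ + ‖iteratedDeriv 2 n t‖ with he₂
    set e₃ := ‖iteratedDeriv 3 u t‖ + ‖iteratedDeriv 3 n t‖ with he₃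
    have hpos : 0 ≤ e₂ * e₁ + e₁ ^ 3 := by positivity
    have he₃' : ‖iteratedDeriv 3 u t‖ + ‖iteratedDeriv 3 n t‖ ≤ 1 * (e₃ + e₂ * e₁ + e₁ ^ 3) := by
      rw [one_mul, he₃, add_assoc]; exact le_add_of_nonneg_right hpos
    calc ‖iteratedDeriv 3 Ft t‖ ≤ ‖iteratedDeriv 3 u t‖ + ‖iteratedDeriv 3 p t‖ +
        ‖iteratedDeriv 3 q t‖ + ‖iteratedDeriv 3 n t‖ := h
      _ ≤ (‖iteratedDeriv 3 u t‖ + ‖iteratedDeriv 3 n t‖) + K₀ * (e₃ + e₂ * e₁ + e₁ ^ 3) +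
          K₀ * (e₃ + e₂ * e₁ + e₁ ^ 3) := by linarith
      _ ≤ 1 * (e₃ + e₂ * e₁ + e₁ ^ 3) + K₀ * (e₃ + e₂ * e₁ + e₁ ^ 3) +
          K₀ * (e₃ + e₂ * e₁ + e₁ ^ 3) := by gcongr
      _ = (1 + 2 * K₀) * (e₃ + e₂ * e₁ + e₁ ^ 3) := by ring

/-- **Registered one-line carrier form** (`higherOrder_transportFrame_EF`) of
`higherOrder_exists_transportFrame`. [folklore] -/
theorem higherOrder_transportFrame_EF : open Literature.Geometry.Lorentzian in ∀ (Λ : ℝ → lorentzGroup) {γ : ℝ}, ContDiff ℝ ((⊤ : ℕ∞) : WithTop ℕ∞) (fun t ↦ ((Λ t : E4 ≃L[ℝ] E4) : E4 →L[ℝ] E4)) → (∀ t, |((Λ t : E4 ≃L[ℝ] E4) (E4.basisVector 0)) 0| ≤ γ) → ∃ (Λ' : ℝ → lorentzGroup) (K : ℝ), 0 ≤ K ∧ ContDiff ℝ ((⊤ : ℕ∞) : WithTop ℕ∞) (fun t ↦ ((Λ' t : E4 ≃L[ℝ] E4) : E4 →L[ℝ] E4)) ∧ (∀ (t : ℝ)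 (c : E4) (M a : ℝ) (z : E4), boostedKerrBilin (Λ' t) c M a z = boostedKerrBilin (Λ t) c M a z) ∧ (∀ t, (Λ' t : E4 ≃L[ℝ] E4) (E4.basisVector 0) = (Λ t : E4 ≃L[ℝ] E4) (E4.basisVector 0)) ∧ (∀ t, (Λ' t : E4 ≃L[ℝ] E4) (E4.basisVector 3) = (Λ t : E4 ≃L[ℝ] E4) (E4.basisVector 3)) ∧ ∀ t, ‖iteratedDeriv 1 (fun s ↦ ((Λ' s : E4 ≃L[ℝ] E4) : E4 →L[ℝ] E4)) t‖ ≤ K * (‖iteratedDeriv 1 (fun s ↦ (Λ s : E4 ≃L[ℝ] E4) (E4.basisVector 0)) t‖ + ‖iteratedDeriv 1 (fun s ↦ (Λ s : E4 ≃L[ℝ] E4) (E4.basisVector 3)) t‖) ∧ ‖iteratedDeriv 2 (fun s ↦ ((Λ' s : E4 ≃L[ℝ] E4) : E4 →L[ℝ] E4)) t‖ ≤ K * ((‖iteratedDeriv 2 (fun s ↦ (Λ s : E4 ≃L[ℝ] E4) (E4.basisVector 0)) t‖ + ‖iteratedDeriv 2 (fun s ↦ (Λ s : E4 ≃L[ℝ]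 E4) (E4.basisVector 3)) t‖) + (‖iteratedDeriv 1 (fun s ↦ (Λ s : E4 ≃L[ℝ] E4) (E4.basisVector 0)) t‖ + ‖iteratedDeriv 1 (fun s ↦ (Λ s : E4 ≃L[ℝ] E4) (E4.basisVector 3)) t‖) ^ 2) ∧ ‖iteratedDeriv 3 (fun s ↦ ((Λ' s : E4 ≃L[ℝ] E4) : E4 →L[ℝ] E4)) t‖ ≤ K * ((‖iteratedDeriv 3 (fun s ↦ (Λ s : E4 ≃L[ℝ] E4) (E4.basisVector 0)) t‖ + ‖iteratedDeriv 3 (fun s ↦ (Λ s : E4 ≃L[ℝ] E4) (E4.basisVector 3)) t‖) + (‖iteratedDeriv 2 (fun s ↦ (Λ s : E4 ≃L[ℝ] E4) (E4.basisVector 0)) t‖ + ‖iteratedDeriv 2 (fun s ↦ (Λ s : E4 ≃L[ℝ] E4) (E4.basisVector 3)) t‖) * (‖iteratedDeriv 1 (fun s ↦ (Λ s : E4 ≃L[ℝ] E4) (E4.basisVector 0)) t‖ + ‖iteratedDeriv 1 (fun s ↦ (Λ s : E4 ≃L[ℝ] E4) (E4.basisVector 3)) t‖) + (‖iteratedDeriv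 1 (fun s ↦ (Λ s : E4 ≃L[ℝ] E4) (E4.basisVector 0)) t‖ + ‖iteratedDeriv 1 (fun s ↦ (Λ s : E4 ≃L[ℝ] E4) (E4.basisVector 3)) t‖) ^ 3) :=
  fun Λ _ hΛ hγ ↦ higherOrder_exists_transportFrame Λ hΛ hγ

end Summit.FinalStateConjecture.FinalStateConjecture.Theorems.SublinearIsFree.Slaving

end
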